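import Literature.MathematicalPhysics.QuantumFieldTheory.BalabanImbrieJaffe1984to88.BIJ88Result5145

/-!
# `BalabanImbrieJaffe1984to88.BIJ88IbpResult312` — T. Bałaban, J. Imbrie, A. Jaffe, *Effective action and cluster properties of the abelian Higgs
model*, Commun. Math. Phys. **114** (1988) 257–315 [BalabanImbrieJaffe1988]: Sect. 5.14, p. 312 [PDF 56], the FIRST display — **the result
of the integrations by parts** (row `C2.Claim@312`, *"observable extraction"*):
*"z_F/z = ⟨Π_{σ₁} F^{m̄}_{k,loc}(X_{σ₁})⟩₁ = Σ_{{X_r}} Π_{c: X_c⊄∪_rX_r} F^L_{k+1,loc}(X_c) ⟨Π_r F_{k,rem}(X_r)⟩₁"* — its SECOND EQUALITY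
DERIVED as the finite resummation identity it is, from the structure print gives the integration-by-parts expansion (the first equality is
gen 7's `BIJ88Result5145.zF_div_z_eq_expect1`; the cluster expansion of each `⟨Π_r F_{k,rem}(X_r)⟩₁` into `Σ Π G_k` is gens 11–12).

HONEST FRAMING (cell `lit-balaban`, verbatim): statement-level skeleton of published theorems with citation tags; proofs where landed; nothing here is a claim about the Yang–Mills mass gap.

PDF held: `paper:balaban1988-cmp114-bij-abelian-higgs-effective-action` (journal page = PDF page + 256); pp. 311–312 = PDF 55–56, read this session.

**The print (verbatim, pp. 311–312).** *"We break up the observable according to the connected components of X. The components containing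
contractions to χ′_{Λ₉^{(k)}}, terms from the random walk expansions, or at least m+1 interactions are called remainder components {X_r}. The
other components are called constant components {X_c}, since the observable there is independent of A^{(k)}, φ^{(k)}. We can arrange the
construction so that the {X_c} are determined once the remainder components are specified. Summing all possible diagrams in X_c gives the
observable for the next step there, F^L_{k+1,loc}(X_c). Summing all terms in X_r gives an observable F_{k,rem}(X_r). Then the result of the
integration by parts is z_F/z = ⟨Π_{σ₁} F^{m̄}_{k,loc}(X_{σ₁})⟩ = Σ_{{X_r}} Π_{c: X_c ⊄ ∪_r X_r} F^L_{k+1,loc}(X_c) ⟨Π_r F_{k,rem}(X_r)⟩₁, where ⟨·⟩₁ is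
the interacting expectation at t = 1."*

**What is proved (0 `sorry`, standard axioms, 0 new `Prop` facts, theorems only).** MODEL READING of the quoted structure: the integration by
parts expands the observable into finitely many terms; a term is indexed by its remainder datum `ρ ∈ R` (the family `{X_r}` with everything
in it), a remainder term `t ∈ RT ρ` (field-dependent value `u ρ t`), and — *"the {X_c} are determined once the remainder components are
specified"* — an independent choice of one diagram `d_c ∈ Dg c` in each constant component `c ∈ CC ρ` (*"X_c ⊄ ∪_r X_r"*), whose value `v c d_c`
is a CONSTANT (*"the observable there is independent of A^{(k)}, φ^{(k)}"*); the term's value is `(Π_c v c d_c) • u ρ t`.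
* **`ibp_result`** — for every ℝ-linear expectation `E`: `E F = Σ_{ρ∈R} (Π_{c∈CC ρ} Σ_{d∈Dg c} v c d) · E(Σ_{t∈RT ρ} u ρ t)`, i.e. the printed
  `Σ_{{X_r}} Π_c F^L_{k+1,loc}(X_c) ⟨Π_r F_{k,rem}(X_r)⟩₁` with `F^L_{k+1,loc}(X_c) := Σ_{d∈Dg c} v c d` (*"Summing all possible diagrams in X_c
  gives … F^L_{k+1,loc}(X_c)"*) and the remainder observable `Σ_{t∈RT ρ} u ρ t` (*"Summing all terms in X_r gives an observable F_{k,rem}(X_r)"*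
  — their product over `r` as one block); the exchange of Σ and Π over the constant components is `Finset.prod_sum`.
* **`expect1_ibp_result`** — the same for gen 7's interacting expectation at `t = 1`, `BIJ88Result5145.expect1 E χ Ys b W′` (it is linear in the
  observable: `expect1_add`, `expect1_smul`, `expect1_sum`), so that with `zF_div_z_eq_expect1` the whole printed display reads
  **`zF_div_z_eq_sum_prod_FL_mul_expect1`**: `z_F/z = Σ_ρ (Π_c F^L(X_c)) · ⟨F_rem ρ⟩₁`.
HONEST SCOPE: the expansion itself (existence of the terms with this structure for the actual F^{m̄}_{k,loc}, the covariances and the random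
walk expansions) is print's construction *"Without going into details"* and enters as the hypothesis `hIBP`; what is certified is the displayed
resummation given that structure. Companion of this seat's `BIJ88ObservableExtraction312` (p319495: the p. 311 component classification,
termination, the p. 312 small-factor arithmetic and the `|G_k|` estimate in printed currency). Imports `BIJ88Result5145` only; modifies nothing.
NOT summit progress; NOT continuum; NOT Clay. Cell `lit-balaban` Phase 2, seat p25 gen 13 (row owner r16, referee ref-5).
-/

noncomputable section

open Finset
open Literature.MathematicalPhysics.QuantumFieldTheory.BalabanImbrieJaffe1984to88.BIJ88Resummation5141 (boltz zF)
open Literature.MathematicalPhysics.QuantumFieldTheory.BalabanImbrieJaffe1984to88.BIJ88Result5145 (expect1 zF_div_z_eq_expect1)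

namespace Literature.MathematicalPhysics.QuantumFieldTheory.BalabanImbrieJaffe1984to88.BIJ88IbpResult312

/-! ## §1 The resummation identity for a linear expectation -/

section Abstract

variable {Φ : Type*} {P γ δ τ : Type*} [DecidableEq γ]

/-- the term sum for a fixed remainder datum factorizes: `Σ_t Σ_{d∈Π_cDg c} (Π_c v c d_c)•u ρ t = (Π_c Σ_d v c d) • Σ_t u ρ t` (exchange of Σ
and Π over the constant components — *"the {X_c} are determined once the remainder components are specified"*). [cite: BalabanImbrieJaffe1988, (5.14.5) p.312] -/
theorem sum_terms_eq_smul (CC : Finset γ) (Dg : γ → Finset δ) (v : γ → δ → ℝ) (RT : Finset τ) (u : τ → Φ → ℝ) :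
    ∑ t ∈ RT, ∑ p ∈ CC.pi (fun c => Dg c), (∏ x ∈ CC.attach, v x.1 (p x.1 x.2)) • u t =
      (∏ c ∈ CC, ∑ d ∈ Dg c, v c d) • ∑ t ∈ RT, u t := by
  rw [Finset.prod_sum, Finset.smul_sum]
  refine sum_congr rfl fun t _ => ?_
  rw [Finset.sum_smul]

/-- **p. 312, the result of the integrations by parts**, verbatim: *"Σ_{{X_r}} Π_{c: X_c ⊄ ∪_r X_r} F^L_{k+1,loc}(X_c) ⟨Π_r F_{k,rem}(X_r)⟩₁"* —
DERIVED for every ℝ-linear expectation `E` from the printed structure of the expansion: terms indexed by the remainder datum `ρ ∈ R`, a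
remainder term `t ∈ RT ρ` with field-dependent value `u ρ t`, and one diagram `d_c ∈ Dg c` per constant component `c ∈ CC ρ` with CONSTANT
value `v c d_c`; then `E F = Σ_ρ (Π_{c∈CC ρ} F^L(X_c)) · E(F_rem ρ)` with `F^L(X_c) = Σ_{d∈Dg c} v c d` (*"Summing all possible diagrams in X_c"*)
and `F_rem ρ = Σ_{t∈RT ρ} u ρ t` (*"Summing all terms in X_r"*). [cite: BalabanImbrieJaffe1988, (5.14.5) p.312] -/
theorem ibp_result (E : (Φ → ℝ) →ₗ[ℝ] ℝ) (R : Finset P) (CC : P → Finset γ) (Dg : γ → Finset δ) (v : γ → δ → ℝ) (RT : P → Finset τ)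
    (u : P → τ → Φ → ℝ) {F : Φ → ℝ}
    (hIBP : F = ∑ ρ ∈ R, ∑ t ∈ RT ρ, ∑ p ∈ (CC ρ).pi (fun c => Dg c), (∏ x ∈ (CC ρ).attach, v x.1 (p x.1 x.2)) • u ρ t) :
    E F = ∑ ρ ∈ R, (∏ c ∈ CC ρ, ∑ d ∈ Dg c, v c d) * E (∑ t ∈ RT ρ, u ρ t) := by
  rw [hIBP, map_sum]
  refine sum_congr rfl fun ρ _ => ?_
  rw [sum_terms_eq_smul, map_smul, smul_eq_mul]

end Abstract

/-! ## §2 For the interacting expectation at `t = 1` of (5.14.1)/(5.14.2) (gen 7's `expect1`) -/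

section Interacting

variable {ι : Type*} [DecidableEq ι] {Φ : Type*} {P γ δ τ : Type*} [DecidableEq γ]

/-- `⟨·⟩₁` is additive in the observable. [cite: BalabanImbrieJaffe1988, (5.14.2) p.308] -/
theorem expect1_add (E : Finset ι → (Φ → ℝ) →ₗ[ℝ] ℝ) (χ : Finset ι → Φ → ℝ) (Ys : Finset (Finset ι)) (b : Finset ι → Φ → ℝ)
    (W' : Finset ι) (O₁ O₂ : Φ → ℝ) :
    expect1 E χ Ys b W' (O₁ + O₂) = expect1 E χ Ys b W' O₁ + expect1 E χ Ys b W' O₂ := by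
  unfold expect1
  rw [← add_div, ← map_add]
  congr 2
  funext φ
  simp only [Pi.mul_apply, Pi.add_apply]
  ring

/-- `⟨·⟩₁` is homogeneous in the observable. [cite: BalabanImbrieJaffe1988, (5.14.2) p.308] -/
theorem expect1_smul (E : Finset ι → (Φ → ℝ) →ₗ[ℝ] ℝ) (χ : Finset ι → Φ → ℝ) (Ys : Finset (Finset ι)) (b : Finset ι → Φ → ℝ)
    (W' : Finset ι) (a : ℝ) (O : Φ → ℝ) :
    expect1 E χ Ys b W' (a • O) = a * expect1 E χ Ys b W' O := by
  unfold expect1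
  rw [mul_div_assoc', ← smul_eq_mul a, ← map_smul]
  congr 2
  funext φ
  simp only [Pi.mul_apply, Pi.smul_apply, smul_eq_mul]
  ring

/-- `⟨·⟩₁` of a finite sum of observables. [cite: BalabanImbrieJaffe1988, (5.14.2) p.308] -/
theorem expect1_sum (E : Finset ι → (Φ → ℝ) →ₗ[ℝ] ℝ) (χ : Finset ι → Φ → ℝ) (Ys : Finset (Finset ι)) (b : Finset ι → Φ → ℝ)
    (W' : Finset ι) {κ : Type*} (s : Finset κ) (O : κ → Φ → ℝ) :
    expect1 E χ Ys b W' (∑ i ∈ s, O i) = ∑ i ∈ s, expect1 E χ Ys b W' (O i) := by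
  classical
  induction s using Finset.induction_on with
  | empty =>
      simp only [sum_empty]
      unfold expect1
      rw [mul_zero, zero_mul, map_zero, zero_div]
  | insert a s ha ih => rw [sum_insert ha, sum_insert ha, expect1_add, ih]

/-- **p. 312, the result of the integrations by parts, IN THE INTERACTING EXPECTATION `⟨·⟩₁`** of p. 308 (gen 7's `BIJ88Result5145.expect1`):
under the printed structure of the expansion of the observable `F W′` in the region `W′`,
`⟨F W′⟩₁ = Σ_{ρ∈R} (Π_{c∈CC ρ} F^L_{k+1,loc}(X_c)) · ⟨F_rem ρ⟩₁`. [cite: BalabanImbrieJaffe1988, (5.14.5) p.312] -/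
theorem expect1_ibp_result (E : Finset ι → (Φ → ℝ) →ₗ[ℝ] ℝ) (χ : Finset ι → Φ → ℝ) (Ys : Finset (Finset ι)) (b : Finset ι → Φ → ℝ)
    (W' : Finset ι) (R : Finset P) (CC : P → Finset γ) (Dg : γ → Finset δ) (v : γ → δ → ℝ) (RT : P → Finset τ) (u : P → τ → Φ → ℝ)
    {F : Φ → ℝ} (hIBP : F = ∑ ρ ∈ R, ∑ t ∈ RT ρ, ∑ p ∈ (CC ρ).pi (fun c => Dg c), (∏ x ∈ (CC ρ).attach, v x.1 (p x.1 x.2)) • u ρ t) :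
    expect1 E χ Ys b W' F = ∑ ρ ∈ R, (∏ c ∈ CC ρ, ∑ d ∈ Dg c, v c d) * expect1 E χ Ys b W' (∑ t ∈ RT ρ, u ρ t) := by
  rw [hIBP, expect1_sum]
  refine sum_congr rfl fun ρ _ => ?_
  rw [sum_terms_eq_smul, expect1_smul]

/-- **THE WHOLE FIRST DISPLAY OF p. 312**, verbatim: *"z_F/z = ⟨Π_{σ₁} F^{m̄}_{k,loc}(X_{σ₁})⟩ = Σ_{{X_r}} Π_{c: X_c⊄∪_rX_r} F^L_{k+1,loc}(X_c)
⟨Π_r F_{k,rem}(X_r)⟩₁"* — the first equality is gen 7's `zF_div_z_eq_expect1` (definition of `⟨·⟩₁`), the second `expect1_ibp_result`: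
`z_F(W′)/z(W′) = Σ_ρ (Π_c F^L(X_c)) · ⟨F_rem ρ⟩₁` for the observable `F W′` of the region `W′`. [cite: BalabanImbrieJaffe1988, (5.14.5) p.312] -/
theorem zF_div_z_eq_sum_prod_FL_mul_expect1 (E : Finset ι → (Φ → ℝ) →ₗ[ℝ] ℝ) (χ F : Finset ι → Φ → ℝ) (Ys : Finset (Finset ι))
    (b : Finset ι → Φ → ℝ) (W' : Finset ι) (R : Finset P) (CC : P → Finset γ) (Dg : γ → Finset δ) (v : γ → δ → ℝ)
    (RT : P → Finset τ) (u : P → τ → Φ → ℝ)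
    (hIBP : F W' = ∑ ρ ∈ R, ∑ t ∈ RT ρ, ∑ p ∈ (CC ρ).pi (fun c => Dg c), (∏ x ∈ (CC ρ).attach, v x.1 (p x.1 x.2)) • u ρ t) :
    zF E (fun W => χ W * F W) Ys b W' / zF E χ Ys b W' =
      ∑ ρ ∈ R, (∏ c ∈ CC ρ, ∑ d ∈ Dg c, v c d) * expect1 E χ Ys b W' (∑ t ∈ RT ρ, u ρ t) := by
  rw [zF_div_z_eq_expect1, expect1_ibp_result E χ Ys b W' R CC Dg v RT u hIBP]

end Interacting

/-! ## §3 (v1.1, append-only) The printed SECOND display with both products, and (5.14.5) fed by it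

p. 312 [PDF 56], verbatim: *"Without going into details, it is clear that the result can be written in the following form:
⟨Π_{σ₁} F^{m̄}_{k,loc}(X_{σ₁})⟩₁ = Σ_{{X_{r′}}} Π_{r′} G_k(X_{r′}) Π_{c: X_c⊄∪_{r′}X_{r′}} F^L_{k+1,loc}(X_c)."* — obtained from the first display
(`expect1_ibp_result`) once each remainder expectation `⟨F_rem ρ⟩₁` is given its cluster expansion `Σ_{φ∈Fam ρ} Π_{X∈φ} G_k(X)` (for the
(5.14.3)-type gas this is gens 11–12: `BIJ88Result5145Obs.expect1_eq_sum_remFamilies`, `BIJ88Expansion5143KP.corner_ratio_eq_sum_prod_Gk_of_ineq5144`);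
the two sums merge into the one printed sum over `{X_{r′}}` (`Finset.sum_sigma`). -/

section SecondDisplay

variable {ι : Type*} [DecidableEq ι] {Φ : Type*} {P γ δ τ : Type*} [DecidableEq γ] {Xt : Type*}

/-- **p. 312, second display, with BOTH printed products**: under the IBP structure `hIBP` and, for every remainder datum `ρ`, a cluster
expansion `hgas ρ : ⟨F_rem ρ⟩₁ = Σ_{φ∈Fam ρ} Π_{X∈φ} G_k X` of its remainder expectation:
`⟨F W′⟩₁ = Σ_{(ρ,φ)} (Π_{X∈φ} G_k X) · Π_{c∈CC ρ} F^L(X_c)` — print's `Σ_{{X_{r′}}} Π_{r′} G_k(X_{r′}) Π_{c: X_c⊄∪X_{r′}} F^L_{k+1,loc}(X_c)` with the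
index `{X_{r′}}` read as the pair (remainder datum, family of the expansion). [cite: BalabanImbrieJaffe1988, (5.14.5) p.312] -/
theorem expect1_eq_sum_prod_Gk_mul_prod_FL (E : Finset ι → (Φ → ℝ) →ₗ[ℝ] ℝ) (χ : Finset ι → Φ → ℝ) (Ys : Finset (Finset ι))
    (b : Finset ι → Φ → ℝ) (W' : Finset ι) (R : Finset P) (CC : P → Finset γ) (Dg : γ → Finset δ) (v : γ → δ → ℝ) (RT : P → Finset τ)
    (u : P → τ → Φ → ℝ) {F : Φ → ℝ}
    (hIBP : F = ∑ ρ ∈ R, ∑ t ∈ RT ρ, ∑ p ∈ (CC ρ).pi (fun c => Dg c), (∏ x ∈ (CC ρ).attach, v x.1 (p x.1 x.2)) • u ρ t)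
    (Fam : P → Finset (Finset Xt)) (Gk : Xt → ℝ) (hgas : ∀ ρ ∈ R, expect1 E χ Ys b W' (∑ t ∈ RT ρ, u ρ t) = ∑ φ ∈ Fam ρ, ∏ X ∈ φ, Gk X) :
    expect1 E χ Ys b W' F = ∑ x ∈ R.sigma Fam, (∏ X ∈ x.2, Gk X) * ∏ c ∈ CC x.1, ∑ d ∈ Dg c, v c d := by
  rw [expect1_ibp_result E χ Ys b W' R CC Dg v RT u hIBP, sum_sigma]
  refine sum_congr rfl fun ρ hρ => ?_
  rw [hgas ρ hρ, mul_sum]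
  exact sum_congr rfl fun φ _ => mul_comm _ _

/-- the same for `z_F/z` (the whole chain of both p. 312 displays). [cite: BalabanImbrieJaffe1988, (5.14.5) p.312] -/
theorem zF_div_z_eq_sum_prod_Gk_mul_prod_FL (E : Finset ι → (Φ → ℝ) →ₗ[ℝ] ℝ) (χ F : Finset ι → Φ → ℝ) (Ys : Finset (Finset ι))
    (b : Finset ι → Φ → ℝ) (W' : Finset ι) (R : Finset P) (CC : P → Finset γ) (Dg : γ → Finset δ) (v : γ → δ → ℝ) (RT : P → Finset τ)
    (u : P → τ → Φ → ℝ)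
    (hIBP : F W' = ∑ ρ ∈ R, ∑ t ∈ RT ρ, ∑ p ∈ (CC ρ).pi (fun c => Dg c), (∏ x ∈ (CC ρ).attach, v x.1 (p x.1 x.2)) • u ρ t)
    (Fam : P → Finset (Finset Xt)) (Gk : Xt → ℝ) (hgas : ∀ ρ ∈ R, expect1 E χ Ys b W' (∑ t ∈ RT ρ, u ρ t) = ∑ φ ∈ Fam ρ, ∏ X ∈ φ, Gk X) :
    zF E (fun W => χ W * F W) Ys b W' / zF E χ Ys b W' = ∑ x ∈ R.sigma Fam, (∏ X ∈ x.2, Gk X) * ∏ c ∈ CC x.1, ∑ d ∈ Dg c, v c d := by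
  rw [zF_div_z_eq_expect1, expect1_eq_sum_prod_Gk_mul_prod_FL E χ Ys b W' R CC Dg v RT u hIBP Fam Gk hgas]

end SecondDisplay

/-! ### (5.14.5) with `h312` replaced by the printed IBP structure and the remainder gas representations -/

section Eq5145

variable {ι : Type*} [DecidableEq ι] {Φ : Type*} {P γ δ τ : Type*} [DecidableEq γ] {Xt : Type*}

open Literature.MathematicalPhysics.QuantumFieldTheory.BalabanImbrieJaffe1984to88.BIJ88Resummation5141 (outer lam12 g2 zS polysIn Compat restrictTo)
open Literature.MathematicalPhysics.QuantumFieldTheory.BalabanImbrieJaffe1984to88.BIJ88Result5145 (eq5145)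
open Literature.Probability.LatticeModels (setPartitions)

/-- **(5.14.5) (gen 7's `BIJ88Result5145.eq5145`, all its displayed inputs verbatim) WITH `h312` DISCHARGED BY THE PRINTED IBP STRUCTURE**: for every
large-field-free region `W′` the observable `F W′` has an IBP expansion `hIBP W′` (remainder data `R W′`, constant components, diagrams with
constant values, remainder terms) and each remainder expectation its cluster expansion `hgas`; then (5.14.5) holds with the observable factor
`Σ_{(ρ,φ)} (Π_{X∈φ} G_k X)·Π_c F^L(X_c)` — both printed products. [cite: BalabanImbrieJaffe1988, (5.14.5) p.312] -/
theorem eq5145_ibp (W B : Finset ι) (g : Finset ι → ℝ) (E : Finset ι → (Φ → ℝ) →ₗ[ℝ] ℝ) (χ F : Finset ι → Φ → ℝ)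
    (Ys : Finset (Finset ι)) (b : Finset ι → Φ → ℝ) (g₁ : Finset ι → Finset (Finset ι) → ℝ)
    (hYs : ∀ Y ∈ Ys, Y.Nonempty) (hg : ∀ X ⊆ W, X.Nonempty → Disjoint X B → g X = g2 Ys g₁ X)
    (hdec : ∀ W' ⊆ W, Disjoint W' B → ∀ S ⊆ polysIn Ys W',
      zS E (fun W => χ W * F W) b W' S = ∑ κ ∈ setPartitions W', if Compat κ S then ∏ X ∈ κ, g₁ X (restrictTo S X) else 0)
    (Vconst PL : ℝ) (𝒳 : Finset (Finset ι)) (pert rem : Finset ι → ℝ) (W6p W6pp : Finset ι → Finset ι → ℝ)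
    (hz : ∀ W' ⊆ W, Disjoint W' B → 0 < zF E χ Ys b W')
    (hlogz : ∀ W' ⊆ W, Disjoint W' B → Real.log (zF E χ Ys b W') = -pert W' - rem W')
    (hrem : ∀ W' ⊆ W, Disjoint W' B → rem W' = ∑ X ∈ 𝒳, W6p W' X)
    (h311 : ∀ W' ⊆ W, Disjoint W' B → Vconst + pert W' = PL + ∑ X ∈ 𝒳, W6pp W' X)
    -- the printed IBP structure of the observable of each region, replacing `h312`
    (R : Finset ι → Finset P) (CC : Finset ι → P → Finset γ) (Dg : Finset ι → γ → Finset δ) (v : Finset ι → γ → δ → ℝ)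
    (RT : Finset ι → P → Finset τ) (u : Finset ι → P → τ → Φ → ℝ)
    (hIBP : ∀ W' ⊆ W, Disjoint W' B → F W' = ∑ ρ ∈ R W', ∑ t ∈ RT W' ρ, ∑ p ∈ (CC W' ρ).pi (fun c => Dg W' c),
      (∏ x ∈ (CC W' ρ).attach, v W' x.1 (p x.1 x.2)) • u W' ρ t)
    (Fam : Finset ι → P → Finset (Finset Xt)) (Gk : Finset ι → Xt → ℝ)
    (hgas : ∀ W' ⊆ W, Disjoint W' B → ∀ ρ ∈ R W',
      expect1 E χ Ys b W' (∑ t ∈ RT W' ρ, u W' ρ t) = ∑ φ ∈ Fam W' ρ, ∏ X ∈ φ, Gk W' X) :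
    Real.exp (-Vconst) * ∑ π ∈ setPartitions W, ∏ X ∈ π, g X =
      ∑ ρ ∈ outer W B, (∏ X ∈ ρ, g X) *
        ((∑ x ∈ (R (lam12 W ρ)).sigma (Fam (lam12 W ρ)),
            (∏ X ∈ x.2, Gk (lam12 W ρ) X) * ∏ c ∈ CC (lam12 W ρ) x.1, ∑ d ∈ Dg (lam12 W ρ) c, v (lam12 W ρ) c d) *
          Real.exp (-PL - ∑ X ∈ 𝒳, (W6p (lam12 W ρ) X + W6pp (lam12 W ρ) X))) :=
  eq5145 W B g E χ F Ys b g₁ hYs hg hdec Vconst PL 𝒳 pert rem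
    (fun W' => ∑ x ∈ (R W').sigma (Fam W'), (∏ X ∈ x.2, Gk W' X) * ∏ c ∈ CC W' x.1, ∑ d ∈ Dg W' c, v W' c d) W6p W6pp hz hlogz hrem h311
    fun W' hW' hdis => expect1_eq_sum_prod_Gk_mul_prod_FL E χ Ys b W' (R W') (CC W') (Dg W') (v W') (RT W') (u W') (hIBP W' hW' hdis)
      (Fam W') (Gk W') (hgas W' hW' hdis)

end Eq5145

end Literature.MathematicalPhysics.QuantumFieldTheory.BalabanImbrieJaffe1984to88.BIJ88IbpResult312

end
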